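/-
Copyright (c) 2026 the pub-hodgecm-mathlib formalisation cell (harness21).  Prover seat hodgecm-mathlib-LH5-p04 (g11), 2026-09-03.  E1 row 56-B3(55-PF) «PLACE-FREE SIBLINGS OF
THE 55-A FILES», file (S): the any-involution ∕ tame twin of ★ A-I-3 `UnitaryLatticeTreeHorocycleSteps` (keeper F0P3a-p03 (g30) 04:09:00Z; census `CENSUS-SIGSHEET-B355PF.v1` 4e3d4b85fe811f96).
-/
import Literature.NumberTheory.Automorphic.UnitaryLatticeTreeHorocycleSteps                 -- ★ A-I-3 p853467 (LH10-p02 (g14)): the datum-free `exists_forall_le_v_le_v_zpow`, `mulVec_of_mem_unipotentU`, `v_zpow_mul_v_zpow`; brings ★ A-I-1 `conj_mem_unipotentU_of_mem_torusU'`, ★ `unipotentU ∕ torusU`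
import Literature.NumberTheory.Automorphic.UnitaryLatticeTreeHorocycleRootStarOfInvolution   -- R1 (F0P2-p01 (g27)): (T) any involution `exists_mem_torusU_latticeGraphIso_apartmentEnum_eq_add_of_involution`; (H2) tame `exists_mem_unipotentU_apply_apartmentEnum_one_eq_of_adj_zero_of_v_two`
import Literature.NumberTheory.Automorphic.UnitaryLatticeTreeHorocycleTypeTwoStarRamified    -- R2 (F0P2-p01 (g27)): (H3) tame `exists_mem_unipotentU_apply_apartmentEnum_zero_eq_of_adj_neg_one_of_neg`
import HarnessLib

/-!
# Horocycle steps of the `U(3)` tree FOR ANY ISOMETRIC INVOLUTION and AT A TAMELY RAMIFIED PLACE: (H1) `N` fixes the end `A(−∞)`; (H4) the star dichotomy at every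
# apartment vertex, hypothesis-style and unconditionally tame (Bruhat–Tits 1972 §10, (4.4.4); Serre, *Trees* II.1.1; Rogawski 1990 §1.10, §4.5)

Topic `NumberTheory/Automorphic`; namespace `Literature.NumberTheory.Automorphic.UnitaryLatticeTree`.  THEOREMS ONLY (no definition, no instance, no notation, no named
fact, no `sorry`).  Cell `pub/hodgecm-mathlib` (D-0151), crux H413 = `stmt-HodgeConjecture-24833`, lane `--supports`; E1 BRICK LEDGER row 56-B3(55-PF) (keeper F0P3a-p03
(g30) 04:09:00Z; LEAD T15-42 (iii) «every ★ datum file of the K1 chain gets its tame sibling»): the PLACE-FREE siblings of the three row-55 files A-I-3 ∕ A-II ∕ A-III, which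
bind the UNRAMIFIED datum `hd : UnramifiedLocalConjDatum σ ϖ` but read of it only `|ϖ| = exp(−1)` and `|σ·| = |·|` — and CALL the genuinely unramified heads (T) (the torus
translation `diag(ϖ^c,1,ϖ^{-c})`, unitary only when `σϖ = ϖ`), (H2)∕(H3) (the star steps at `A 0`, `A (−1)`), and the tree-ness of the lattice graph.  This file is the sibling
of A-I-3 `UnitaryLatticeTreeHorocycleSteps` ((H1), (H4)); its siblings of A-I-1 ∕ A-I-2 are `UnitaryLatticeTreeHorocycleRootStarOfInvolution` ∕ `…TypeTwoStarRamified`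
(F0P2-p01 (g27)), imported here.  HONEST LABEL: count-neutral generic lattice-tree layer (TAME road GO-LOW, WILD = PRINT; E1 = PRINT); HC_CM is proved only modulo the 7
printed citations (2 remaining named inputs hLiu418 = `stmt-HodgeConjecture-24832`, h413 = `stmt-HodgeConjecture-24833`) until rung 0 closes; nothing printed is asserted
here — elementary lattice algebra over a valued field.

THE SETTING.  `K` a valued field, `σ` an isometric involution (`σ² = 1`, `|σ·| = |·|`), `ϖ` a uniformiser (`|ϖ| = exp(−1)`; NO hypothesis on `σϖ` in Layer I; `σϖ = −ϖ`
in Layer II), `J₀ = antidiag(1,1,1)`, `U = U(σ, J₀)` acting on the lattice graph by ★ `latticeGraphIso`; `B ≥ T, N` (★ `UnitaryGroup.borelU ∕ torusU ∕ unipotentU`).  The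
enumerated standard apartment `A : ℤ → 𝓥` is HYPOTHESIS-STYLE `(A, hA0, hA1)` exactly as in ★ 39γ ∕ ★ B1 `exists_apartmentEnum_of_involution`: `A (2a) = latt diag(ϖ^a, 1,
ϖ^{-a})`, `A (2a+1) = latt diag(ϖ^{a+1}, 1, ϖ^{-a})` — the SAME lattices at every place (diagonal lattices only see valuations), carried by the any-involution torus
`t_c = diag(ϖ^c, 1, (σϖ)^{-c})` of R1 ∕ ★ R5a.

THIS FILE (two layers, ★ B3(53)'s pattern; conclusions VERBATIM = ★ A-I-3's; names = ★ name + suffix).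
* §1 **(H1) `…_of_mem_unipotentU_of_v (hϖ)`** — PLACE-FREE: `hd` was read for `|ϖ|` only.
* §2 LAYER I **(H4) `…_of_adj_of_involution (hσ hvσ hϖ) (A hA0 hA1) (hH2) (hH3)`** — the star dichotomy for ANY isometric involution, with the two star steps (H2)∕(H3)
  HYPOTHESIS-STYLE (their ★ conclusions ∀-closed) and the torus translation from R1's any-involution (T).
* §3 LAYER II **(H4) `…_of_adj_of_neg (hσ hvσ hϖ hσϖ hres h2)`** — TAME discharge by R1 §2 (`t = ½`) and R2 (letters = ★ `isTree_latticeGraph_three_of_neg`'s, in order,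
  only those used: no `hnorm`, no `ValuativeRel`).

## References
* [BruhatTits1972] F. Bruhat, J. Tits, *Groupes réductifs sur un corps local I*, Publ. Math. IHÉS 41 (1972), §10 (lattice models of the rank-one unitary building), (4.4.4)
  (the stabiliser of a vertex is transitive on the chambers containing it), (7.4.18).
* [Tits1979] J. Tits, *Reductive groups over local fields*, Proc. Sympos. Pure Math. 33.1 (1979), §2.4 (the ramified quasi-split `SU₃`: both vertex types special), §3.3.3.
* [Serre1980Trees] J.-P. Serre, *Trees* (1980), Ch. II §1.1 (the tree of `SL₂`: lattices, the apartment of diagonal lattices, the action of unipotent matrices), Ch. I §2.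
* [Rogawski1990] J. D. Rogawski, *Automorphic Representations of Unitary Groups in Three Variables*, Ann. of Math. Stud. 123 (1990), §1.10 p. 9 (`B = MN`, `N = {u(x, z)}`,
  `d(α, β, ᾱ⁻¹)`), §4.5 p. 45 (Iwasawa decomposition).
-/

set_option autoImplicit false

open scoped Valued WithZero Matrix MatrixGroups

namespace Literature.NumberTheory.Automorphic.UnitaryLatticeTree

open _root_.SimpleGraph Literature.NumberTheory.Automorphic Literature.NumberTheory.Automorphic.HermitianLattice
open Literature.NumberTheory.Automorphic.CartanUnique (uniformizer_ne_zero uniformizer_mem_integer)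
open Literature.NumberTheory.Automorphic.UnitaryGroup

variable {K : Type*} [Field K] [Valued K ℤᵐ⁰] {σ : K →+* K} {ϖ : K}

/-! ## §1 (H1) for any uniformiser: `N` fixes the end `A(−∞)` of the apartment -/

/-- **(H1) FOR ANY UNIFORMISER — `N` FIXES THE END `A(−∞)`**: every `n ∈ N` fixes all apartment vertices `A j`, `j ≤ j₀(n)`.  Twin of ★
`exists_forall_le_latticeGraphIso_apartmentEnum_eq_self_of_mem_unipotentU`: the datum `hd` was read only for `|ϖ| = exp(−1)` (`ϖ ≠ 0` and «every value is eventually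
`≤ |ϖ^a|`»), so the token pass `hd ↦ hϖ` gives the conclusion VERBATIM for any involution `σ` and any uniformiser `ϖ`; proof = ★'s byte for byte (the entries of
`diag(ϖ^{e₀},1,ϖ^{e₂})⁻¹ · n⁻¹ · diag(ϖ^{e₀},1,ϖ^{e₂})` above the diagonal are `n⁻¹₀₁ ϖ^{-e₀}`, `n⁻¹₀₂ ϖ^{e₂-e₀}`, `n⁻¹₁₂ ϖ^{e₂}`, small for `e₀ → −∞`, `e₂ → +∞`).
[cite: Serre1980Trees, II.1.1] [cite: BruhatTits1972, §10] [cite: Rogawski1990, §1.10 p. 9] -/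
theorem exists_forall_le_latticeGraphIso_apartmentEnum_eq_self_of_mem_unipotentU_of_v (hϖ : Valued.v ϖ = WithZero.exp (-1 : ℤ))
    (A : ℤ → {M : Submodule 𝒪[K] (Fin 3 → K) // IsVertex σ ϖ ((StdForm.antidiagonal 3).over K) M})
    (hA0 : ∀ a : ℤ, (A (2 * a)).1 = latt (Matrix.diagonal ![ϖ ^ a, (1 : K), ϖ ^ (-a)]))
    (hA1 : ∀ a : ℤ, (A (2 * a + 1)).1 = latt (Matrix.diagonal ![ϖ ^ (a + 1), (1 : K), ϖ ^ (-a)]))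
    {n : unitaryGroupOfForm σ ((StdForm.antidiagonal 3).over K)}
    (hn : n ∈ unipotentU σ ((StdForm.antidiagonal 3).over K)) :
    ∃ j₀ : ℤ, ∀ j ≤ j₀, latticeGraphIso σ ϖ ((StdForm.antidiagonal 3).over K) n (A j) = A j := by
  have hϖ0 : ϖ ≠ 0 := uniformizer_ne_zero hϖ
  have hni : n⁻¹ ∈ unipotentU σ ((StdForm.antidiagonal 3).over K) := Subgroup.inv_mem _ hn
  set p : K := (((n⁻¹ : unitaryGroupOfForm σ ((StdForm.antidiagonal 3).over K)) : GL (Fin 3) K) : Matrix (Fin 3) (Fin 3) K) 0 1 with hp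
  set q : K := (((n⁻¹ : unitaryGroupOfForm σ ((StdForm.antidiagonal 3).over K)) : GL (Fin 3) K) : Matrix (Fin 3) (Fin 3) K) 0 2 with hq
  set r : K := (((n⁻¹ : unitaryGroupOfForm σ ((StdForm.antidiagonal 3).over K)) : GL (Fin 3) K) : Matrix (Fin 3) (Fin 3) K) 1 2 with hr
  obtain ⟨mp, hmp⟩ := exists_forall_le_v_le_v_zpow hϖ p
  obtain ⟨mq, hmq⟩ := exists_forall_le_v_le_v_zpow hϖ q
  obtain ⟨mr, hmr⟩ := exists_forall_le_v_le_v_zpow hϖ r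
  refine ⟨min (2 * mp - 3) (min (mq - 1) (2 * mr - 1)), fun j hj => ?_⟩
  have h1 : j ≤ 2 * mp - 3 := hj.trans (min_le_left _ _)
  have h2 : j ≤ mq - 1 := hj.trans ((min_le_right _ _).trans (min_le_left _ _))
  have h3 : j ≤ 2 * mr - 1 := hj.trans ((min_le_right _ _).trans (min_le_right _ _))
  -- the even and odd vertices `A (2a) = latt diag(ϖ^a,1,ϖ^{-a})`, `A (2a+1) = latt diag(ϖ^{a+1},1,ϖ^{-a})` uniformly: `latt diag(ϖ^{e₀}, 1, ϖ^{e₂})`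
  suffices key : ∀ e₀ e₂ : ℤ, Valued.v p ≤ Valued.v (ϖ ^ e₀) → Valued.v q ≤ Valued.v (ϖ ^ (e₀ - e₂)) → Valued.v r ≤ Valued.v (ϖ ^ (-e₂)) →
      mapGL (n : GL (Fin 3) K) (latt (Matrix.diagonal ![ϖ ^ e₀, (1 : K), ϖ ^ e₂])) = latt (Matrix.diagonal ![ϖ ^ e₀, (1 : K), ϖ ^ e₂]) by
    apply Subtype.ext
    change mapGL (n : GL (Fin 3) K) (A j).1 = (A j).1
    obtain ⟨a, rfl | rfl⟩ := Int.even_or_odd' j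
    · rw [hA0]
      exact key a (-a) (hmp a (by omega)) (hmq _ (by omega)) (hmr _ (by omega))
    · rw [hA1]
      exact key (a + 1) (-a) (hmp _ (by omega)) (hmq _ (by omega)) (hmr _ (by omega))
  intro e₀ e₂ hvp hvq hvr
  have hD : ∀ i, (![ϖ ^ e₀, (1 : K), ϖ ^ e₂] : Fin 3 → K) i ≠ 0 := by
    intro i; fin_cases i <;> simp [zpow_ne_zero _ hϖ0]
  have hL : ∀ x : Fin 3 → K, x ∈ latt (Matrix.diagonal ![ϖ ^ e₀, (1 : K), ϖ ^ e₂]) ↔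
      Valued.v (x 0) ≤ Valued.v (ϖ ^ e₀) ∧ Valued.v (x 1) ≤ 1 ∧ Valued.v (x 2) ≤ Valued.v (ϖ ^ e₂) := fun x => by
    rw [mem_latt_diagonal_iff hD, Fin.forall_fin_succ, Fin.forall_fin_two]
    simp only [Fin.succ_zero_eq_one, Fin.succ_one_eq_two, Matrix.cons_val_zero, Matrix.cons_val_one, Matrix.cons_val_two, Matrix.tail_cons, Matrix.head_cons, map_one]
  -- the two mixed estimates
  have hqx : ∀ x₂ : K, Valued.v x₂ ≤ Valued.v (ϖ ^ e₂) → Valued.v (q * x₂) ≤ Valued.v (ϖ ^ e₀) := fun x₂ hx₂ => by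
    rw [map_mul]
    calc Valued.v q * Valued.v x₂ ≤ Valued.v (ϖ ^ (e₀ - e₂)) * Valued.v (ϖ ^ e₂) := mul_le_mul' hvq hx₂
      _ = Valued.v (ϖ ^ e₀) := by rw [v_zpow_mul_v_zpow hϖ0, sub_add_cancel]
  have hrx : ∀ x₂ : K, Valued.v x₂ ≤ Valued.v (ϖ ^ e₂) → Valued.v (r * x₂) ≤ 1 := fun x₂ hx₂ => by
    rw [map_mul]
    calc Valued.v r * Valued.v x₂ ≤ Valued.v (ϖ ^ (-e₂)) * Valued.v (ϖ ^ e₂) := mul_le_mul' hvr hx₂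
      _ = 1 := by rw [v_zpow_mul_v_zpow hϖ0, neg_add_cancel, zpow_zero, map_one]
  have hpx : ∀ x₁ : K, Valued.v x₁ ≤ 1 → Valued.v (p * x₁) ≤ Valued.v (ϖ ^ e₀) := fun x₁ hx₁ => by
    rw [map_mul]
    calc Valued.v p * Valued.v x₁ ≤ Valued.v (ϖ ^ e₀) * 1 := mul_le_mul' hvp hx₁
      _ = Valued.v (ϖ ^ e₀) := mul_one _
  ext x
  rw [mem_mapGL_iff, ← Subgroup.coe_inv, hL, hL]
  obtain ⟨e0, e1, e2⟩ := mulVec_of_mem_unipotentU hni x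
  rw [e0, e1, e2, ← hp, ← hq, ← hr]
  constructor
  · rintro ⟨h0, h1', h2'⟩
    have hx1 : Valued.v (x 1) ≤ 1 := by
      rw [show x 1 = (x 1 + r * x 2) - r * x 2 by ring]; exact Valuation.map_sub_le _ h1' (hrx _ h2')
    refine ⟨?_, hx1, h2'⟩
    rw [show x 0 = (x 0 + p * x 1 + q * x 2) - p * x 1 - q * x 2 by ring]
    exact Valuation.map_sub_le _ (Valuation.map_sub_le _ h0 (hpx _ hx1)) (hqx _ h2')
  · rintro ⟨h0, h1', h2'⟩
    exact ⟨Valuation.map_add_le _ (Valuation.map_add_le _ h0 (hpx _ h1')) (hqx _ h2'), Valuation.map_add_le _ h1' (hrx _ h2'), h2'⟩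

/-! ## §2 Layer I — the star dichotomy for any isometric involution, star steps hypothesis-style -/

/-- **(H4) FOR ANY ISOMETRIC INVOLUTION, HYPOTHESIS-STYLE — THE STAR DICHOTOMY AT EVERY APARTMENT VERTEX**: a neighbour `y` of `A j` is EITHER the inward
neighbour `A (j − 1)` OR `n · A (j + 1)` for some `n ∈ N` fixing `A j`.  Twin of ★ `eq_apartmentEnum_sub_one_or_exists_mem_unipotentU_of_adj` with the datum `hd` replaced
by `(hσ, hvσ, hϖ)` and its two UNRAMIFIED-ROOTED inputs taken HYPOTHESIS-STYLE: `hH2` = the star step at the self-dual vertex `A 0` (★ (H2)'s conclusion, ∀-closed) and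
`hH3` = the star step at the type-two vertex `A (−1)` (★ (H3)'s conclusion, ∀-closed); the torus translation `t_c` is the any-involution (T) `diag(ϖ^c, 1, (σϖ)^{-c})`
(`exists_mem_torusU_latticeGraphIso_apartmentEnum_eq_add_of_involution`), which normalises `N` (★ `conj_mem_unipotentU_of_mem_torusU'`).  Conclusion VERBATIM; proof =
★'s with the three callees swapped.  Dischargers: unramified `hH2 := ★ (H2) hd`, `hH3 := ★ (H3) hd`; tame `…_of_adj_of_neg` below.
[cite: BruhatTits1972, (4.4.4) and §10] [cite: Serre1980Trees, II.1.1] [cite: Rogawski1990, §1.10 p. 9; §4.5 p. 45] -/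
theorem eq_apartmentEnum_sub_one_or_exists_mem_unipotentU_of_adj_of_involution (hσ : ∀ x, σ (σ x) = x) (hvσ : ∀ a, Valued.v (σ a) = Valued.v a) (hϖ : Valued.v ϖ = WithZero.exp (-1 : ℤ))
    (A : ℤ → {M : Submodule 𝒪[K] (Fin 3 → K) // IsVertex σ ϖ ((StdForm.antidiagonal 3).over K) M})
    (hA0 : ∀ a : ℤ, (A (2 * a)).1 = latt (Matrix.diagonal ![ϖ ^ a, (1 : K), ϖ ^ (-a)]))
    (hA1 : ∀ a : ℤ, (A (2 * a + 1)).1 = latt (Matrix.diagonal ![ϖ ^ (a + 1), (1 : K), ϖ ^ (-a)]))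
    (hH2 : ∀ y : {M : Submodule 𝒪[K] (Fin 3 → K) // IsVertex σ ϖ ((StdForm.antidiagonal 3).over K) M}, (latticeGraph σ ϖ ((StdForm.antidiagonal 3).over K)).Adj (A 0) y → y ≠ A (-1) →
      ∃ n : unitaryGroupOfForm σ ((StdForm.antidiagonal 3).over K), n ∈ unipotentU σ ((StdForm.antidiagonal 3).over K) ∧
        latticeGraphIso σ ϖ ((StdForm.antidiagonal 3).over K) n (A 0) = A 0 ∧ latticeGraphIso σ ϖ ((StdForm.antidiagonal 3).over K) n (A 1) = y)
    (hH3 : ∀ y : {M : Submodule 𝒪[K] (Fin 3 → K) // IsVertex σ ϖ ((StdForm.antidiagonal 3).over K) M}, (latticeGraph σ ϖ ((StdForm.antidiagonal 3).over K)).Adj (A (-1)) y → y ≠ A (-2) →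
      ∃ n : unitaryGroupOfForm σ ((StdForm.antidiagonal 3).over K), n ∈ unipotentU σ ((StdForm.antidiagonal 3).over K) ∧
        latticeGraphIso σ ϖ ((StdForm.antidiagonal 3).over K) n (A (-1)) = A (-1) ∧ latticeGraphIso σ ϖ ((StdForm.antidiagonal 3).over K) n (A 0) = y)
    (j : ℤ)
    {y : {M : Submodule 𝒪[K] (Fin 3 → K) // IsVertex σ ϖ ((StdForm.antidiagonal 3).over K) M}}
    (hy : (latticeGraph σ ϖ ((StdForm.antidiagonal 3).over K)).Adj (A j) y) :
    y = A (j - 1) ∨ ∃ n : unitaryGroupOfForm σ ((StdForm.antidiagonal 3).over K), n ∈ unipotentU σ ((StdForm.antidiagonal 3).over K) ∧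
      latticeGraphIso σ ϖ ((StdForm.antidiagonal 3).over K) n (A j) = A j ∧ latticeGraphIso σ ϖ ((StdForm.antidiagonal 3).over K) n (A (j + 1)) = y := by
  -- reduce to a base vertex `A j₀`, `j₀ ∈ {0, −1}`, along the torus translation `t_c`
  suffices key : ∀ c j₀ : ℤ, (j₀ = 0 ∨ j₀ = -1) → j = j₀ + 2 * c →
      y = A (j - 1) ∨ ∃ n : unitaryGroupOfForm σ ((StdForm.antidiagonal 3).over K), n ∈ unipotentU σ ((StdForm.antidiagonal 3).over K) ∧
        latticeGraphIso σ ϖ ((StdForm.antidiagonal 3).over K) n (A j) = A j ∧ latticeGraphIso σ ϖ ((StdForm.antidiagonal 3).over K) n (A (j + 1)) = y by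
    obtain ⟨c, rfl | rfl⟩ := Int.even_or_odd' j
    · exact key c 0 (Or.inl rfl) (by ring)
    · exact key (c + 1) (-1) (Or.inr rfl) (by ring)
  intro c j₀ hj₀ hj
  obtain ⟨t, htT, -, htA⟩ := exists_mem_torusU_latticeGraphIso_apartmentEnum_eq_add_of_involution hσ hvσ hϖ A hA0 hA1 c
  set y₀ := latticeGraphIso σ ϖ ((StdForm.antidiagonal 3).over K) t⁻¹ y with hy₀
  have hty₀ : latticeGraphIso σ ϖ ((StdForm.antidiagonal 3).over K) t y₀ = y := latticeGraphIso_mul_inv_apply t y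
  have hadj : (latticeGraph σ ϖ ((StdForm.antidiagonal 3).over K)).Adj (A j₀) y₀ := by
    have h := hy
    rw [hj, ← htA j₀, ← hty₀] at h
    exact (latticeGraphIso σ ϖ ((StdForm.antidiagonal 3).over K) t).map_adj_iff.1 h
  -- the base step at `A 0` (§2) or `A (−1)` (§3)
  have base : y₀ = A (j₀ - 1) ∨ ∃ n : unitaryGroupOfForm σ ((StdForm.antidiagonal 3).over K), n ∈ unipotentU σ ((StdForm.antidiagonal 3).over K) ∧
      latticeGraphIso σ ϖ ((StdForm.antidiagonal 3).over K) n (A j₀) = A j₀ ∧ latticeGraphIso σ ϖ ((StdForm.antidiagonal 3).over K) n (A (j₀ + 1)) = y₀ := by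
    rcases hj₀ with rfl | rfl
    · by_cases h : y₀ = A (-1)
      · exact Or.inl (by rw [h]; norm_num)
      · obtain ⟨n, h1, h2, h3⟩ := hH2 _ hadj h
        exact Or.inr ⟨n, h1, h2, by rw [zero_add]; exact h3⟩
    · by_cases h : y₀ = A (-2)
      · exact Or.inl (by rw [h]; norm_num)
      · obtain ⟨n, h1, h2, h3⟩ := hH3 _ hadj h
        exact Or.inr ⟨n, h1, h2, by rw [show (-1 : ℤ) + 1 = 0 by norm_num]; exact h3⟩
  rcases base with h | ⟨n, hnN, hn0, hn1⟩
  · left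
    rw [← hty₀, h, htA, hj]
    congr 1; ring
  · right
    refine ⟨t * n * t⁻¹, conj_mem_unipotentU_of_mem_torusU' htT hnN, ?_, ?_⟩
    · rw [hj, ← htA j₀, latticeGraphIso_mul_apply, latticeGraphIso_mul_apply, latticeGraphIso_inv_mul_apply, hn0]
    · rw [hj, show j₀ + 2 * c + 1 = (j₀ + 1) + 2 * c by ring, ← htA (j₀ + 1), latticeGraphIso_mul_apply, latticeGraphIso_mul_apply,
        latticeGraphIso_inv_mul_apply, hn1, hty₀]

/-! ## §3 Layer II — the star dichotomy at a tamely ramified place, unconditionally -/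

/-- **(H4) AT A TAMELY RAMIFIED PLACE — THE STAR DICHOTOMY, UNCONDITIONALLY**: `σ` an isometric involution with `σϖ = −ϖ`, residually trivial (`hres`), `|2| = 1`.
The hypothesis-style (H4) with `hH2` discharged by the trace-`½` star step `exists_mem_unipotentU_apply_apartmentEnum_one_eq_of_adj_zero_of_v_two` and `hH3` by the
ramified type-two star step `exists_mem_unipotentU_apply_apartmentEnum_zero_eq_of_adj_neg_one_of_neg` (F0P2-p01 (g27), R1∕R2).  Conclusion VERBATIM = ★ (H4)'s; this is the
form the tame twin of the datum file 55-B calls (token pass `hd ↦ hσ hvσ hϖ hσϖ hres h2`). [cite: BruhatTits1972, (4.4.4) and §10] [cite: Tits1979, §2.4]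
[cite: Serre1980Trees, II.1.1] [cite: Rogawski1990, §1.10 p. 9] -/
theorem eq_apartmentEnum_sub_one_or_exists_mem_unipotentU_of_adj_of_neg (hσ : ∀ x, σ (σ x) = x) (hvσ : ∀ a, Valued.v (σ a) = Valued.v a) (hϖ : Valued.v ϖ = WithZero.exp (-1 : ℤ)) (hσϖ : σ ϖ = -ϖ)
    (hres : ∀ x : K, Valued.v x ≤ 1 → Valued.v (σ x - x) < 1) (h2 : Valued.v (2 : K) = 1)
    (A : ℤ → {M : Submodule 𝒪[K] (Fin 3 → K) // IsVertex σ ϖ ((StdForm.antidiagonal 3).over K) M})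
    (hA0 : ∀ a : ℤ, (A (2 * a)).1 = latt (Matrix.diagonal ![ϖ ^ a, (1 : K), ϖ ^ (-a)]))
    (hA1 : ∀ a : ℤ, (A (2 * a + 1)).1 = latt (Matrix.diagonal ![ϖ ^ (a + 1), (1 : K), ϖ ^ (-a)]))
    (j : ℤ)
    {y : {M : Submodule 𝒪[K] (Fin 3 → K) // IsVertex σ ϖ ((StdForm.antidiagonal 3).over K) M}}
    (hy : (latticeGraph σ ϖ ((StdForm.antidiagonal 3).over K)).Adj (A j) y) :
    y = A (j - 1) ∨ ∃ n : unitaryGroupOfForm σ ((StdForm.antidiagonal 3).over K), n ∈ unipotentU σ ((StdForm.antidiagonal 3).over K) ∧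
      latticeGraphIso σ ϖ ((StdForm.antidiagonal 3).over K) n (A j) = A j ∧ latticeGraphIso σ ϖ ((StdForm.antidiagonal 3).over K) n (A (j + 1)) = y :=
  eq_apartmentEnum_sub_one_or_exists_mem_unipotentU_of_adj_of_involution hσ hvσ hϖ A hA0 hA1
    (fun _ hy₀ hy₀' => exists_mem_unipotentU_apply_apartmentEnum_one_eq_of_adj_zero_of_v_two hσ hvσ hϖ h2 A hA0 hA1 hy₀ hy₀')
    (fun _ hy₀ hy₀' => exists_mem_unipotentU_apply_apartmentEnum_zero_eq_of_adj_neg_one_of_neg hσ hvσ hϖ hσϖ hres h2 A hA0 hA1 hy₀ hy₀') j hy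

end Literature.NumberTheory.Automorphic.UnitaryLatticeTree
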